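import Mathlib.AlgebraicGeometry.ProjectiveSpectrum.Proper
import Mathlib.RingTheory.MvPolynomial.Homogeneous
import Mathlib.AlgebraicGeometry.Morphisms.Smooth
import Mathlib.AlgebraicGeometry.Morphisms.ClosedImmersion
import Mathlib.AlgebraicGeometry.Morphisms.Proper
import Mathlib.AlgebraicGeometry.Geometrically.Irreducible
import Mathlib.AlgebraicGeometry.Geometrically.Integral
import Mathlib.AlgebraicGeometry.Pullbacks
import Mathlib.AlgebraicGeometry.Noetherian
import Mathlib.CategoryTheory.Comma.Over.Pullback
import Mathlib.Topology.KrullDimension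
import Mathlib.Order.KrullDimension
import HarnessLib

-- provenance: harness21/H21/H21/Prelude/MotiveAbstract/Varieties.lean @ af542ab (interim HEAD d8f2665); M5 mechanical rewrite
/-!
# Smooth projective varieties over a field (trunk T-MOTIVE, prelude C1)

This file fixes the vocabulary of `k`-schemes and smooth projective varieties used throughout
the `MotiveAbstract` prelude (points, abelian varieties, cycles, Weil cohomology theories).

* `Literature.SchemeOver k` is Mathlib's `Over (Spec k)`; it is a cartesian monoidal category
  (`X ⊗ Y` is the fibre product over `k`, `𝟙_` is `Spec k`, see
  `Mathlib.AlgebraicGeometry.Pullbacks`).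
* `Literature.projectiveSpace n k` is `ℙⁿ_k`, realised as `Proj k[x₀, …, xₙ]` with the grading of
  `MvPolynomial.homogeneousSubmodule` (Mathlib has `Proj` and `AffineSpace`, but no projective
  space as a scheme: searched `ProjectiveSpace` in `Mathlib/AlgebraicGeometry`, 0 hits).
* `Literature.IsSmoothProjective n X`: `X → Spec k` is smooth of relative dimension `n`
  (Mathlib `SmoothOfRelativeDimension`), admits a closed immersion into some `ℙᴺ_k` over `k`,
  and is geometrically irreducible (Mathlib `GeometricallyIrreducible`). Since smooth morphisms are
  geometrically reduced, this is the usual "smooth projective geometrically integral variety of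
  dimension `n`" (Mathlib `GeometricallyIntegral.of_geometricallyReduced_of_geometricallyIrreducible`
  is the real-proof route for `IsSmoothProjective.geometricallyIntegral`).
* `Literature.schemeDim X : ℕ` is the topological Krull dimension truncated to `ℕ` (junk value `0` on the
  empty scheme and on infinite-dimensional schemes).

Design: the predicate is *unbundled* and carries the dimension as a parameter, mirroring
`SmoothOfRelativeDimension`, so that degree bookkeeping downstream (`H²ⁿ`, Poincaré duality) is
cast-free.

## References

* R. Hartshorne, *Algebraic Geometry*, II.4–II.5, III.10.
* The Stacks project, Tags 01W7 (projective morphisms), 0C15 / 01V4 (smooth morphisms),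
  0366 (geometrically irreducible), 054Q (dimension of varieties).
-/

universe u

open CategoryTheory AlgebraicGeometry MonoidalCategory

namespace Literature.AlgebraicGeometry.Motives

/-- The category of schemes over a commutative ring `k`, i.e. Mathlib's `Over (Spec k)`.
It is cartesian monoidal: `X ⊗ Y = X ×ₖ Y` and `𝟙_ = Spec k`
(Hartshorne, *Algebraic Geometry*, II.3). [folklore] -/
abbrev SchemeOver (k : Type u) [CommRing k] : Type (u + 1) :=
  Over (Spec (CommRingCat.of k))

section Base

variable (k : Type u) [CommRing k] (L : Type u) [CommRing L] [Algebra k L]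

/-- `Spec L` as a `k`-scheme via the structure map `k → L` (Hartshorne II.2). [folklore] -/
noncomputable abbrev specOver : SchemeOver k :=
  Over.mk (Spec.map (CommRingCat.ofHom (algebraMap k L)))

/-- Base change of `k`-schemes along `k → L`, `X ↦ X ×ₖ Spec L`, as the pullback functor
`Over (Spec k) ⥤ Over (Spec L)` (Hartshorne II.3, "base extension"). [folklore] -/
noncomputable def baseChange : SchemeOver k ⥤ SchemeOver L :=
  Over.pullback (Spec.map (CommRingCat.ofHom (algebraMap k L)))

end Base

section Projective

variable (n : ℕ) (k : Type u) [Field k]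

/-- Projective `n`-space `ℙⁿ_k = Proj k[x₀, …, xₙ]` as a `k`-scheme, the structure morphism being
`Proj 𝒜 → Spec (𝒜 0) → Spec k` for the grading `𝒜 = MvPolynomial.homogeneousSubmodule (Fin (n+1)) k`
(Hartshorne II.2.5 and II.4; Stacks 01M6). [folklore] -/
noncomputable def projectiveSpace : SchemeOver k :=
  letI := MvPolynomial.gradedAlgebra (σ := Fin (n + 1)) (R := k)
  Over.mk (Proj.toSpecZero (MvPolynomial.homogeneousSubmodule (Fin (n + 1)) k) ≫
    Spec.map (CommRingCat.ofHom
      (algebraMap k (MvPolynomial.homogeneousSubmodule (Fin (n + 1)) k 0))))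

variable {k}

/-- A `k`-scheme `X` is *projective over `k`* if it admits a closed immersion of `k`-schemes into
some `ℙⁿ_k` (Hartshorne II.4, definition before 4.9; Stacks 01W7). [folklore] -/
def IsProjectiveOver (X : SchemeOver k) : Prop :=
  ∃ (n : ℕ) (ι : X ⟶ projectiveSpace n k), IsClosedImmersion ι.left

/-- A chosen projective embedding of a `k`-scheme `X`: a closed `k`-immersion `ι : X ↪ ℙⁿ_k`
(Hartshorne II.4–II.5). Used downstream to name hyperplane classes. [folklore] -/
structure ProjectiveEmbedding (X : SchemeOver k) where
  /-- The dimension of the ambient projective space. -/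
  n : ℕ
  /-- The embedding `X ⟶ ℙⁿ_k` over `k`. -/
  ι : X ⟶ projectiveSpace n k
  /-- The embedding is a closed immersion. -/
  isClosedImmersion : IsClosedImmersion ι.left

attribute [instance] ProjectiveEmbedding.isClosedImmersion

/-- A scheme with a chosen projective embedding is projective over `k`. [folklore] -/
theorem ProjectiveEmbedding.isProjectiveOver {X : SchemeOver k} (e : ProjectiveEmbedding X) :
    IsProjectiveOver X :=
  ⟨e.n, e.ι, e.isClosedImmersion⟩

/-- Every projective `k`-scheme has a projective embedding (choice). [folklore] -/
noncomputable def IsProjectiveOver.projectiveEmbedding {X : SchemeOver k}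
    (h : IsProjectiveOver X) : ProjectiveEmbedding X :=
  ⟨h.choose, h.choose_spec.choose, h.choose_spec.choose_spec⟩

/-- `X` is a *smooth projective (geometrically integral) variety of dimension `n` over `k`*:
the structure morphism `X → Spec k` is smooth of relative dimension `n`, `X` is projective over
`k`, and `X` is geometrically irreducible over `k`. Smooth implies geometrically reduced, so `X` is
geometrically integral (`IsSmoothProjective.geometricallyIntegral`, via Mathlib
`GeometricallyIntegral.of_geometricallyReduced_of_geometricallyIrreducible`); this is the notion of
Hartshorne I.3 / II.4–5, III.10 and Stacks 0C15, 0366, 01W7. [folklore] -/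
structure IsSmoothProjective (n : ℕ) (X : SchemeOver k) : Prop where
  /-- `X → Spec k` is smooth of relative dimension `n`. -/
  smoothOfRelativeDimension : SmoothOfRelativeDimension n X.hom
  /-- `X` admits a closed `k`-immersion into some projective space. -/
  isProjectiveOver : IsProjectiveOver X
  /-- `X` is geometrically irreducible over `k`. -/
  geometricallyIrreducible : GeometricallyIrreducible X.hom

end Projective

/-- The dimension of a scheme as a natural number: the Krull dimension of its underlying
topological space (Mathlib `topologicalKrullDim`), with junk value `0` for the empty scheme
(`⊥`) and for infinite-dimensional schemes (`⊤`) (Hartshorne I.1 and II Ex. 3.20). [folklore] -/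
noncomputable def schemeDim (X : Scheme.{u}) : ℕ :=
  ((topologicalKrullDim X).unbotD 0).toNat

section API

variable {k : Type u} [Field k] {n m : ℕ} {X Y : SchemeOver k}

/-- A smooth projective variety of relative dimension `n` has dimension `n`
(Hartshorne II Ex. 3.20, III.10.1; Stacks 054Q, 02NL). [cite: Hartshorne1977, III.10 (definition of relative dimension preceding Prop. 10.1) and II Ex. 3.20] [cite: StacksProject, Tag 054Q] -/
def schemeDim_eq : Prop :=
  ∀ (h : IsSmoothProjective n X),
    schemeDim X.left = n

namespace IsSmoothProjective

/-- Projective morphisms are proper (Hartshorne II.4.9; Stacks 01WC). [cite: Hartshorne1977, II.4.9; Stacks 01WC] -/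
def isProper : Prop :=
  ∀ (h : IsSmoothProjective n X),
    IsProper X.hom

/-- A smooth, geometrically irreducible `k`-scheme is geometrically integral: smooth ⇒
geometrically reduced (Stacks 056T) and Mathlib
`GeometricallyIntegral.of_geometricallyReduced_of_geometricallyIrreducible`. [cite: StacksProject, Tag 056T] -/
def geometricallyIntegral : Prop :=
  ∀ (h : IsSmoothProjective n X),
    GeometricallyIntegral X.hom

/-- A smooth projective variety is an integral scheme (Hartshorne II.3, Stacks 0366, 056T). [cite: StacksProject, Section 0366 (geometrically integral ⇒ integral)] -/
def isIntegral : Prop :=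
  ∀ (h : IsSmoothProjective n X),
    IsIntegral X.left

/- interim proof relied on results that are now named facts (D-0014); demoted to a fact by the M5 import, proof preserved:
:=
  have := h.geometricallyIntegral
  GeometricallyIntegral.isIntegral_of_subsingleton X.hom
-/

/-- A projective `k`-scheme is quasi-compact over `k` (Hartshorne II.4.9). [cite: Hartshorne1977, II.4.9] -/
def quasiCompact : Prop :=
  ∀ (h : IsSmoothProjective n X),
    QuasiCompact X.hom

/- interim proof relied on results that are now named facts (D-0014); demoted to a fact by the M5 import, proof preserved:
:=
  have := h.isProper
  inferInstance
-/

/-- The underlying space of a projective `k`-scheme is compact (quasi-compact over the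
quasi-compact `Spec k`; Hartshorne II.4.9). [cite: Hartshorne1977, II.4.9] -/
def compactSpace : Prop :=
  ∀ (h : IsSmoothProjective n X),
    CompactSpace X.left

/- interim proof relied on results that are now named facts (D-0014); demoted to a fact by the M5 import, proof preserved:
:=
  have := h.quasiCompact
  QuasiCompact.compactSpace_of_compactSpace X.hom
-/

/-- A scheme of finite type over a field is locally Noetherian (Hartshorne II.3.2, Hilbert basis
theorem; Stacks 01T6). [cite: Hartshorne1977, II.3.2; Stacks 01T6] -/
def isLocallyNoetherian : Prop :=
  ∀ (h : IsSmoothProjective n X),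
    IsLocallyNoetherian X.left

/-- Discharge of the named fact `IsSmoothProjective.isLocallyNoetherian`: `X → Spec k` is smooth,
hence locally of finite type, and `Spec k` is Noetherian, so `X` is locally Noetherian
(Hartshorne, *Algebraic Geometry*, II.3: definition p. 83 and Prop. 3.2, Ex. 3.13(g) "if
`f : X → Y` is of finite type and `Y` is noetherian then `X` is noetherian", Example 3.2.1;
Mathlib `LocallyOfFiniteType.isLocallyNoetherian`). [cite: Hartshorne1977, II Prop. 3.2 and II Ex. 3.13(g)] [cite: StacksProject, Tag 01T6] -/
theorem isLocallyNoetherian_holds : isLocallyNoetherian (n := n) (X := X) := by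
  intro h
  have := h.smoothOfRelativeDimension
  have : Smooth X.hom := SmoothOfRelativeDimension.smooth n X.hom
  exact LocallyOfFiniteType.isLocallyNoetherian X.hom

/-- Products of smooth projective varieties are smooth projective, of the sum of the dimensions:
smoothness and geometric irreducibility are stable under base change and composition, and
`ℙⁿ ×ₖ ℙᵐ ↪ ℙⁿᵐ⁺ⁿ⁺ᵐ` by the Segre embedding (Hartshorne II Ex. 5.11, III.10.1;
Stacks 01WE, 038F). [cite: Hartshorne1977, III.10.1 and II Ex. 5.11; Stacks 038F] -/
def tensor : Prop :=
  ∀ (hX : IsSmoothProjective n X) (hY : IsSmoothProjective m Y),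
    IsSmoothProjective (n + m) (X ⊗ Y)

end IsSmoothProjective

-- Layout note (defact-verdict 2026-08-15): this named fact is declared with its dotted name
-- *outside* `namespace IsSmoothProjective` (exactly like `IsSmoothProjective.baseChangeHom` in
-- `Motives/BaseChange.lean`), so that its written name is not the bare `baseChange` of the
-- base-change FUNCTOR `Literature.AlgebraicGeometry.Motives.baseChange` above (the named-fact
-- census keys facts by written name). Fully-qualified name, statement and implicit arguments
-- `{k} [Field k] {n} {X}` are unchanged; it is discharged by
-- `Literature.AlgebraicGeometry.Motives.IsSmoothProjective.baseChange_holds`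
-- (`Motives/BaseChangeProofs.lean`).
/-- Smooth projective varieties are stable under extension of the base field
(Hartshorne III.10.1(b), II.4.8(c); Stacks 038F, 01WF). [cite: Hartshorne1977, III.10.1(b) and II.4.8(c); Stacks 038F] -/
def IsSmoothProjective.baseChange : Prop :=
  ∀ (L : Type u) [Field L] [Algebra k L] (hX : IsSmoothProjective n X),
    IsSmoothProjective n ((Literature.AlgebraicGeometry.Motives.baseChange k L).obj X)

variable (n k)

/-- Projective space `ℙⁿ_k` is a smooth projective variety of dimension `n`
(Hartshorne II.4.8, III.10.1; Stacks 01WB, 05FS). [cite: Hartshorne1977, II.4.8 and III.10.1; Stacks 01WB] -/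
def isSmoothProjective_projectiveSpace : Prop :=
  IsSmoothProjective n (projectiveSpace n k)

/-- The point `Spec k = 𝟙_ (SchemeOver k)` is a smooth projective variety of dimension `0`
(`Spec k ≅ ℙ⁰_k`; Hartshorne II.4). [cite: Hartshorne1977, II.4] -/
def isSmoothProjective_unit : Prop :=
  IsSmoothProjective 0 (𝟙_ (SchemeOver k))

/-- For `1 ≤ n`, projective space `ℙⁿ_k` has a point of codimension one, i.e. the generic point of
a hyperplane (Hartshorne I.7, II.6.4). [cite: Hartshorne1977, II.6.4] -/
def exists_coheight_eq_one_projectiveSpace : Prop :=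
  ∀ (hn : 1 ≤ n),
    ∃ x : ↥(projectiveSpace n k).left, Order.coheight x = 1

end API

end Literature.AlgebraicGeometry.Motives
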